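import Mathlib.Analysis.Normed.Affine.AddTorsorBases
import Mathlib.Analysis.Normed.Affine.Convex
import Mathlib.Analysis.Convex.Between
import Mathlib.LinearAlgebra.AffineSpace.FiniteDimensional
import Mathlib.LinearAlgebra.Complex.FiniteDimensional
import Mathlib.Topology.Algebra.Order.Floor
import Mathlib.Topology.Algebra.Affine
import Literature.Probability.RandomPlanarGeometry.PlanarDomains
import HarnessLib

/-!
# Triangles as Jordan domains and as conformal rectangles

Topic `Literature/Probability/RandomPlanarGeometry`. A concrete family of `Literature.Probability.RandomPlanarGeometry.JordanDomain`s /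
`Literature.Probability.RandomPlanarGeometry.ConformalRectangle`s beyond the unit disc of `PlanarDomains.lean`: the open solid triangle
`interior (convexHull ℝ {a, b, c})` of three affinely independent points of `ℂ`, with boundary
loop the piecewise-linear perimeter `a → b → c → a` (parametrised on `[0, 1/3]`, `[1/3, 2/3]`,
`[2/3, 1]` and extended `1`-periodically), and, for `s ∈ (0, 1)`, the conformal rectangle
`(Δ; a, b, c, d)` with fourth marked point `d = c + s (a - c)` on the side `ca`
(marks `0, 1/3, 2/3, (2 + s)/3`).

This is **Carleson's 4-marked domain `T_x`** (Bollobás–Riordan, *Percolation* (2006), Ch. 7,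
p. 163, Fig. 4: the equilateral triangle `P_1 = (1,0), P_2 = (1/2, √3/2), P_3 = (0,0)` with
`P_4 = (x, 0)`), the domain on which Cardy's formula is linear; it makes the hypotheses of
crit-perc.S17 `cardyFunction_crossRatio_eq_of_equilateral` (`CritPercCardyFunction.lean`: "any
conformal rectangle whose carrier is the open triangle with marked points `a, b, c, d`")
inhabited, and serves (in the sequel `Percolation/CardyCarleson.lean`) to reduce the
Cardy–Carleson identity (C) of `Percolation/SmirnovTheorem.lean` to S17; the barycentric
coordinates `(triangleBasis a b c h).coord` are also the linear functions `h¹, h², h³` of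
Bollobás–Riordan's Claim 24 (p. 201: "two-thirds of the distance from `z` to the `i`th side").

Everything here is proved (no named facts). The proofs run through the barycentric coordinates
of the affine basis `triangleBasis a b c` (Mathlib's `AffineBasis.interior_convexHull`,
`AffineBasis.convexHull_eq_nonneg_coord`): the open triangle is `{all coordinates > 0}`, its
frontier `{all ≥ 0, one = 0}` (`frontier_interior_convexHull_triangle`), which is the range of
the perimeter loop.

## Mathlib

USED: `AffineBasis`, `AffineBasis.coord`, `AffineBasis.interior_convexHull`,
`AffineBasis.convexHull_eq_nonneg_coord`, `AffineBasis.centroid_mem_interior_convexHull`,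
`AffineMap.lineMap`, `Convex.closure_interior_eq_closure_of_nonempty_interior`,
`Set.Finite.isCompact_convexHull`, `Int.fract`, `ContinuousOn.comp_fract''`,
`affineIndependent_iff_not_collinear_set`. Mathlib has bundled triangles
(`Affine.Simplex ℝ P 2`) but no Jordan-curve packaging of their boundary.

## References

* B. Bollobás, O. Riordan, *Percolation*, CUP (2006), Ch. 7, p. 163 (Carleson's domain `T_x`).
* S. Smirnov, arXiv:0909.4499, Cor. 3 (Cardy's formula in Carleson's form).
-/

open Set Filter Topology

noncomputable section

namespace Literature.Probability.RandomPlanarGeometry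

/-! ### The affine basis of a non-degenerate triangle -/

/-- The affine basis `(a, b, c)` of `ℂ` over `ℝ` given by three affinely independent points
(three points span the real plane). [folklore] -/
def triangleBasis (a b c : ℂ) (h : AffineIndependent ℝ ![a, b, c]) : AffineBasis (Fin 3) ℝ ℂ :=
  ⟨![a, b, c], h, by
    rw [h.affineSpan_eq_top_iff_card_eq_finrank_add_one, Fintype.card_fin,
      Complex.finrank_real_complex]⟩

variable {a b c : ℂ}

/-- The first basis point is `a`. [folklore] -/
@[simp] theorem triangleBasis_apply_zero (h : AffineIndependent ℝ ![a, b, c]) :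
    triangleBasis a b c h 0 = a := rfl

/-- The second basis point is `b`. [folklore] -/
@[simp] theorem triangleBasis_apply_one (h : AffineIndependent ℝ ![a, b, c]) :
    triangleBasis a b c h 1 = b := rfl

/-- The third basis point is `c`. [folklore] -/
@[simp] theorem triangleBasis_apply_two (h : AffineIndependent ℝ ![a, b, c]) :
    triangleBasis a b c h 2 = c := rfl

/-- The range of the triangle basis is `{a, b, c}`. [folklore] -/
theorem range_triangleBasis (h : AffineIndependent ℝ ![a, b, c]) :
    range (triangleBasis a b c h) = {a, b, c} := by
  ext z
  simp only [mem_range, mem_insert_iff, mem_singleton_iff]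
  constructor
  · rintro ⟨i, rfl⟩
    fin_cases i
    exacts [Or.inl rfl, Or.inr (Or.inl rfl), Or.inr (Or.inr rfl)]
  · rintro (rfl | rfl | rfl)
    exacts [⟨0, rfl⟩, ⟨1, rfl⟩, ⟨2, rfl⟩]

/-- Barycentric coordinates along an edge: the `k`-th coordinate of `lineMap (β i) (β j) u` is
`(1 - u) δ_{ki} + u δ_{kj}`. [folklore] -/
theorem AffineBasis.coord_lineMap_apply {ι : Type*} (β : AffineBasis ι ℝ ℂ) [DecidableEq ι]
    (i j k : ι) (u : ℝ) :
    β.coord k (AffineMap.lineMap (β i) (β j) u) =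
      (1 - u) * (if k = i then 1 else 0) + u * (if k = j then 1 else 0) := by
  rw [AffineMap.apply_lineMap, AffineMap.lineMap_apply_module, β.coord_apply, β.coord_apply]
  simp [smul_eq_mul]

/-! ### The perimeter loop -/

/-- One period of the perimeter loop of the triangle `abc`: `a → b` on `[0, 1/3]`, `b → c` on
`[1/3, 2/3]`, `c → a` on `[2/3, 1]` (affine on each piece; junk affine extension outside
`[0, 1]`). [folklore] -/
def triangleLoopAux (a b c : ℂ) (t : ℝ) : ℂ :=
  if t ≤ 1 / 3 then AffineMap.lineMap a b (3 * t)
  else if t ≤ 2 / 3 then AffineMap.lineMap b c (3 * t - 1)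
  else AffineMap.lineMap c a (3 * t - 2)

/-- The `1`-periodic perimeter loop of the triangle `abc`: `triangleLoopAux ∘ Int.fract`. [folklore] -/
def triangleLoop (a b c : ℂ) : ℝ → ℂ :=
  triangleLoopAux a b c ∘ Int.fract

/-- The loop starts at `a`. [folklore] -/
theorem triangleLoopAux_zero (a b c : ℂ) : triangleLoopAux a b c 0 = a := by
  simp [triangleLoopAux]

/-- After one period the loop is back at `a`. [folklore] -/
theorem triangleLoopAux_one (a b c : ℂ) : triangleLoopAux a b c 1 = a := by
  have h1 : ¬ ((1 : ℝ) ≤ 1 / 3) := by norm_num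
  have h2 : ¬ ((1 : ℝ) ≤ 2 / 3) := by norm_num
  simp only [triangleLoopAux, h1, h2, if_false]
  norm_num

/-- At parameter `1/3` the loop is at `b`. [folklore] -/
theorem triangleLoopAux_one_third (a b c : ℂ) : triangleLoopAux a b c (1 / 3) = b := by
  simp [triangleLoopAux]

/-- At parameter `2/3` the loop is at `c`. [folklore] -/
theorem triangleLoopAux_two_thirds (a b c : ℂ) : triangleLoopAux a b c (2 / 3) = c := by
  have h1 : ¬ ((2 / 3 : ℝ) ≤ 1 / 3) := by norm_num
  simp only [triangleLoopAux, h1, if_false, le_refl, if_true]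
  norm_num

/-- On `(2/3, 1]` the loop runs along the side `ca`: `t ↦ c + (3t - 2)(a - c)`. [folklore] -/
theorem triangleLoopAux_of_two_thirds_lt {t : ℝ} (ht : 2 / 3 < t) :
    triangleLoopAux a b c t = AffineMap.lineMap c a (3 * t - 2) := by
  have h1 : ¬ (t ≤ 1 / 3) := by intro h; linarith
  have h2 : ¬ (t ≤ 2 / 3) := not_le.2 ht
  simp only [triangleLoopAux, h1, h2, if_false]

/-- The perimeter loop is continuous on `ℝ` (the affine pieces agree at `1/3` and `2/3`). [folklore] -/
theorem continuous_triangleLoopAux (a b c : ℂ) : Continuous (triangleLoopAux a b c) := by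
  unfold triangleLoopAux
  refine Continuous.if_le ?_ ?_ continuous_id continuous_const ?_
  · exact AffineMap.lineMap_continuous.comp (continuous_const.mul continuous_id)
  · refine Continuous.if_le ?_ ?_ continuous_id continuous_const ?_
    · exact AffineMap.lineMap_continuous.comp ((continuous_const.mul continuous_id).sub
        continuous_const)
    · exact AffineMap.lineMap_continuous.comp ((continuous_const.mul continuous_id).sub
        continuous_const)
    · intro x hx
      subst hx
      norm_num
  · intro x hx
    subst hx
    norm_num

/-- The `1`-periodic loop is continuous (`triangleLoopAux 0 = triangleLoopAux 1 = a`). [folklore] -/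
theorem continuous_triangleLoop (a b c : ℂ) : Continuous (triangleLoop a b c) :=
  ContinuousOn.comp_fract'' (continuous_triangleLoopAux a b c).continuousOn
    ((triangleLoopAux_zero a b c).trans (triangleLoopAux_one a b c).symm)

/-- The loop is `1`-periodic. [folklore] -/
theorem periodic_triangleLoop (a b c : ℂ) : (triangleLoop a b c).Periodic 1 := fun t => by
  simp [triangleLoop, Int.fract_add_one]

/-- On the fundamental period `[0, 1)` the periodic loop is `triangleLoopAux`. [folklore] -/
theorem triangleLoop_of_mem_Ico {t : ℝ} (ht : t ∈ Ico (0 : ℝ) 1) :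
    triangleLoop a b c t = triangleLoopAux a b c t := by
  simp [triangleLoop, Int.fract_eq_self.2 ⟨ht.1, ht.2⟩]

/-! ### Barycentric description of the loop and of the frontier -/

section Coordinates

variable (h : AffineIndependent ℝ ![a, b, c])

/-- Coordinates of the loop on `[0, 1/3]` (side `ab`): `(1 - 3t, 3t, 0)`. [folklore] -/
theorem coord_triangleLoopAux_of_le {t : ℝ} (ht : t ≤ 1 / 3) (k : Fin 3) :
    (triangleBasis a b c h).coord k (triangleLoopAux a b c t) =
      ![1 - 3 * t, 3 * t, 0] k := by
  have : triangleLoopAux a b c t =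
      AffineMap.lineMap (triangleBasis a b c h 0) (triangleBasis a b c h 1) (3 * t) := by
    rw [triangleLoopAux, if_pos ht]; rfl
  rw [this, AffineBasis.coord_lineMap_apply]
  fin_cases k <;> simp

/-- Coordinates of the loop on `(1/3, 2/3]` (side `bc`): `(0, 2 - 3t, 3t - 1)`. [folklore] -/
theorem coord_triangleLoopAux_of_mem {t : ℝ} (ht : 1 / 3 < t) (ht' : t ≤ 2 / 3) (k : Fin 3) :
    (triangleBasis a b c h).coord k (triangleLoopAux a b c t) =
      ![0, 2 - 3 * t, 3 * t - 1] k := by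
  have : triangleLoopAux a b c t =
      AffineMap.lineMap (triangleBasis a b c h 1) (triangleBasis a b c h 2) (3 * t - 1) := by
    rw [triangleLoopAux, if_neg (not_le.2 ht), if_pos ht']; rfl
  rw [this, AffineBasis.coord_lineMap_apply]
  fin_cases k <;> simp; ring

/-- Coordinates of the loop on `(2/3, ∞)` (side `ca`): `(3t - 2, 0, 3 - 3t)`. [folklore] -/
theorem coord_triangleLoopAux_of_lt {t : ℝ} (ht : 2 / 3 < t) (k : Fin 3) :
    (triangleBasis a b c h).coord k (triangleLoopAux a b c t) =
      ![3 * t - 2, 0, 3 - 3 * t] k := by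
  have : triangleLoopAux a b c t =
      AffineMap.lineMap (triangleBasis a b c h 2) (triangleBasis a b c h 0) (3 * t - 2) := by
    rw [triangleLoopAux_of_two_thirds_lt ht]; rfl
  rw [this, AffineBasis.coord_lineMap_apply]
  fin_cases k <;> simp; ring

/-- Every point of the loop (on `[0, 1]`) has nonnegative barycentric coordinates, one of which
vanishes. [folklore] -/
theorem coord_triangleLoopAux_nonneg_and_exists_eq_zero {t : ℝ} (ht : t ∈ Icc (0 : ℝ) 1) :
    (∀ k, 0 ≤ (triangleBasis a b c h).coord k (triangleLoopAux a b c t)) ∧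
      ∃ k, (triangleBasis a b c h).coord k (triangleLoopAux a b c t) = 0 := by
  rcases le_or_gt t (1 / 3) with h1 | h1
  · refine ⟨fun k => ?_, ⟨2, ?_⟩⟩
    · rw [coord_triangleLoopAux_of_le h h1]
      fin_cases k <;> simp <;> linarith [ht.1]
    · rw [coord_triangleLoopAux_of_le h h1]; simp
  rcases le_or_gt t (2 / 3) with h2 | h2
  · refine ⟨fun k => ?_, ⟨0, ?_⟩⟩
    · rw [coord_triangleLoopAux_of_mem h h1 h2]
      fin_cases k <;> simp <;> linarith
    · rw [coord_triangleLoopAux_of_mem h h1 h2]; simp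
  · refine ⟨fun k => ?_, ⟨1, ?_⟩⟩
    · rw [coord_triangleLoopAux_of_lt h h2]
      fin_cases k <;> simp <;> linarith [ht.2]
    · rw [coord_triangleLoopAux_of_lt h h2]; simp

/-- Conversely, a point with nonnegative barycentric coordinates one of which vanishes lies on
the loop, at a parameter in `[0, 1)`. [folklore] -/
theorem exists_triangleLoopAux_eq {z : ℂ} (h0 : ∀ k, 0 ≤ (triangleBasis a b c h).coord k z)
    (hz : ∃ k, (triangleBasis a b c h).coord k z = 0) :
    ∃ t ∈ Ico (0 : ℝ) 1, triangleLoopAux a b c t = z := by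
  set β := triangleBasis a b c h with hβ
  have hsum : β.coord 0 z + β.coord 1 z + β.coord 2 z = 1 := by
    have := β.sum_coord_apply_eq_one z
    rw [Fin.sum_univ_three] at this
    exact this
  obtain ⟨k, hk⟩ := hz
  fin_cases k
  · -- coordinate of `a` vanishes: `z` is on the side `bc`, `z = lineMap b c u`, `u = coord 2`.
    simp only [Fin.zero_eta] at hk
    set u := β.coord 2 z with hu
    have hu0 : 0 ≤ u := h0 2
    have hu1 : u ≤ 1 := by have := h0 1; linarith
    rcases lt_or_eq_of_le hu1 with hu1 | hu1
    · refine ⟨(1 + u) / 3, ⟨by linarith, by linarith⟩, β.ext_elem fun k => ?_⟩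
      have h1 : 1 / 3 < (1 + u) / 3 ∨ u = 0 := by
        rcases lt_or_eq_of_le hu0 with h' | h'
        · left; linarith
        · right; exact h'.symm
      rcases h1 with h1 | h1
      · rw [coord_triangleLoopAux_of_mem h h1 (by linarith)]
        fin_cases k <;> simp <;> linarith
      · -- `u = 0`: then `z = b`, parameter `1/3`.
        have h13 : (1 + u) / 3 ≤ 1 / 3 := by rw [h1]; norm_num
        rw [coord_triangleLoopAux_of_le h h13]
        fin_cases k <;> simp <;> linarith
    · -- `u = 1`: `z = c`, parameter `2/3`.
      refine ⟨2 / 3, ⟨by norm_num, by norm_num⟩, β.ext_elem fun k => ?_⟩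
      rw [coord_triangleLoopAux_of_mem h (by norm_num) le_rfl]
      fin_cases k <;> simp <;> linarith
  · -- coordinate of `b` vanishes: `z` on the side `ca`.
    simp only [Fin.mk_one] at hk
    set u := β.coord 0 z with hu
    have hu0 : 0 ≤ u := h0 0
    have hu1 : u ≤ 1 := by have := h0 2; linarith
    rcases lt_or_eq_of_le hu0 with hu0' | hu0'
    · rcases lt_or_eq_of_le hu1 with hu1' | hu1'
      · refine ⟨(2 + u) / 3, ⟨by linarith, by linarith⟩, β.ext_elem fun k => ?_⟩
        rw [coord_triangleLoopAux_of_lt h (by linarith)]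
        fin_cases k <;> simp <;> linarith
      · -- `u = 1`: `z = a`, parameter `0`.
        refine ⟨0, ⟨le_rfl, by norm_num⟩, β.ext_elem fun k => ?_⟩
        rw [coord_triangleLoopAux_of_le h (by norm_num)]
        fin_cases k <;> simp <;> linarith
    · -- `u = 0`: `z = c`, parameter `2/3`.
      refine ⟨2 / 3, ⟨by norm_num, by norm_num⟩, β.ext_elem fun k => ?_⟩
      rw [coord_triangleLoopAux_of_mem h (by norm_num) le_rfl]
      fin_cases k <;> simp <;> linarith
  · -- coordinate of `c` vanishes: `z` on the side `ab`.
    simp only [Fin.reduceFinMk] at hk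
    set u := β.coord 1 z with hu
    have hu0 : 0 ≤ u := h0 1
    have hu1 : u ≤ 1 := by have := h0 0; linarith
    refine ⟨u / 3, ⟨by linarith, by linarith⟩, β.ext_elem fun k => ?_⟩
    rw [coord_triangleLoopAux_of_le h (by linarith)]
    fin_cases k <;> simp <;> linarith

include h in
/-- The perimeter loop is injective on one period `[0, 1)`. [folklore] -/
theorem injOn_triangleLoopAux : InjOn (triangleLoopAux a b c) (Ico 0 1) := by
  intro s hs t ht hst
  set β := triangleBasis a b c h
  have hc : ∀ k, β.coord k (triangleLoopAux a b c s) = β.coord k (triangleLoopAux a b c t) :=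
    fun k => by rw [hst]
  -- compare coordinates piece by piece
  rcases le_or_gt s (1 / 3) with hs1 | hs1 <;> rcases le_or_gt t (1 / 3) with ht1 | ht1
  · have := hc 1
    rw [coord_triangleLoopAux_of_le h hs1, coord_triangleLoopAux_of_le h ht1] at this
    simp at this; linarith
  · rcases le_or_gt t (2 / 3) with ht2 | ht2
    · have := hc 0
      rw [coord_triangleLoopAux_of_le h hs1, coord_triangleLoopAux_of_mem h ht1 ht2] at this
      have h2 := hc 2
      rw [coord_triangleLoopAux_of_le h hs1, coord_triangleLoopAux_of_mem h ht1 ht2] at h2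
      simp at this h2; linarith
    · have := hc 1
      rw [coord_triangleLoopAux_of_le h hs1, coord_triangleLoopAux_of_lt h ht2] at this
      have h2 := hc 2
      rw [coord_triangleLoopAux_of_le h hs1, coord_triangleLoopAux_of_lt h ht2] at h2
      simp at this h2; linarith [ht.2]
  · rcases le_or_gt s (2 / 3) with hs2 | hs2
    · have := hc 0
      rw [coord_triangleLoopAux_of_mem h hs1 hs2, coord_triangleLoopAux_of_le h ht1] at this
      have h2 := hc 2
      rw [coord_triangleLoopAux_of_mem h hs1 hs2, coord_triangleLoopAux_of_le h ht1] at h2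
      simp at this h2; linarith
    · have := hc 1
      rw [coord_triangleLoopAux_of_lt h hs2, coord_triangleLoopAux_of_le h ht1] at this
      have h2 := hc 2
      rw [coord_triangleLoopAux_of_lt h hs2, coord_triangleLoopAux_of_le h ht1] at h2
      simp at this h2; linarith [hs.2]
  · rcases le_or_gt s (2 / 3) with hs2 | hs2 <;> rcases le_or_gt t (2 / 3) with ht2 | ht2
    · have := hc 1
      rw [coord_triangleLoopAux_of_mem h hs1 hs2, coord_triangleLoopAux_of_mem h ht1 ht2] at this
      simp at this; linarith
    · have := hc 1
      rw [coord_triangleLoopAux_of_mem h hs1 hs2, coord_triangleLoopAux_of_lt h ht2] at this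
      have h0 := hc 0
      rw [coord_triangleLoopAux_of_mem h hs1 hs2, coord_triangleLoopAux_of_lt h ht2] at h0
      simp at this h0; linarith
    · have := hc 1
      rw [coord_triangleLoopAux_of_lt h hs2, coord_triangleLoopAux_of_mem h ht1 ht2] at this
      have h0 := hc 0
      rw [coord_triangleLoopAux_of_lt h hs2, coord_triangleLoopAux_of_mem h ht1 ht2] at h0
      simp at this h0; linarith
    · have := hc 0
      rw [coord_triangleLoopAux_of_lt h hs2, coord_triangleLoopAux_of_lt h ht2] at this
      simp at this; linarith

/-- **The frontier of an open triangle** is the set of points of the closed triangle with a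
vanishing barycentric coordinate (the union of the three sides). [folklore] -/
theorem frontier_interior_convexHull_triangle :
    frontier (interior (convexHull ℝ {a, b, c})) =
      {z | (∀ k, 0 ≤ (triangleBasis a b c h).coord k z) ∧
        ∃ k, (triangleBasis a b c h).coord k z = 0} := by
  set β := triangleBasis a b c h
  have hr : ({a, b, c} : Set ℂ) = range β := (range_triangleBasis h).symm
  have hK : IsClosed (convexHull ℝ ({a, b, c} : Set ℂ)) :=
    (Set.toFinite _).isClosed_convexHull ℝ
  have hne : (interior (convexHull ℝ ({a, b, c} : Set ℂ))).Nonempty := by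
    rw [hr]; exact ⟨_, β.centroid_mem_interior_convexHull⟩
  have hcl : closure (interior (convexHull ℝ ({a, b, c} : Set ℂ))) = convexHull ℝ {a, b, c} := by
    rw [(convex_convexHull (𝕜 := ℝ) (s := ({a, b, c} : Set ℂ))).closure_interior_eq_closure_of_nonempty_interior hne,
      hK.closure_eq]
  rw [frontier, interior_interior, hcl, hr, β.interior_convexHull, β.convexHull_eq_nonneg_coord]
  ext z
  simp only [Set.mem_sdiff, mem_setOf_eq, not_forall, not_lt]
  constructor
  · rintro ⟨h0, k, hk⟩
    exact ⟨h0, k, le_antisymm hk (h0 k)⟩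
  · rintro ⟨h0, k, hk⟩
    exact ⟨h0, k, hk.le⟩

include h in
/-- The range of the perimeter loop is the frontier of the open triangle. [folklore] -/
theorem range_triangleLoop :
    range (triangleLoop a b c) = frontier (interior (convexHull ℝ {a, b, c})) := by
  rw [frontier_interior_convexHull_triangle h]
  ext z
  simp only [mem_range, mem_setOf_eq]
  constructor
  · rintro ⟨t, rfl⟩
    simp only [triangleLoop, Function.comp_apply]
    exact coord_triangleLoopAux_nonneg_and_exists_eq_zero h
      ⟨Int.fract_nonneg t, (Int.fract_lt_one t).le⟩
  · rintro ⟨h0, hz⟩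
    obtain ⟨t, ht, rfl⟩ := exists_triangleLoopAux_eq h h0 hz
    exact ⟨t, triangleLoop_of_mem_Ico ht⟩

end Coordinates

/-! ### The triangle as a Jordan domain and as a conformal rectangle -/

/-- **The open triangle as a Jordan domain**: carrier `interior (convexHull ℝ {a, b, c})`,
boundary loop the perimeter `a → b → c → a`. (Bollobás–Riordan 2006, Ch. 7 p. 163, Carleson's
domain; Werner 2007, §3.) [cite: BollobasRiordan2006, Ch. 7 p. 163] -/
def triangleDomain (a b c : ℂ) (h : AffineIndependent ℝ ![a, b, c]) : JordanDomain where
  carrier := interior (convexHull ℝ {a, b, c})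
  boundary := triangleLoop a b c
  isOpen := isOpen_interior
  isBounded := ((Set.toFinite _).isCompact_convexHull ℝ).isBounded.subset interior_subset
  isConnected := by
    refine ⟨?_, ((convex_convexHull (𝕜 := ℝ) (s := ({a, b, c} : Set ℂ))).interior).isPreconnected⟩
    rw [← range_triangleBasis h]
    exact ⟨_, (triangleBasis a b c h).centroid_mem_interior_convexHull⟩
  continuous_boundary := continuous_triangleLoop a b c
  periodic_boundary := periodic_triangleLoop a b c
  injOn_boundary := by
    intro s hs t ht hst
    rw [triangleLoop_of_mem_Ico hs, triangleLoop_of_mem_Ico ht] at hst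
    exact injOn_triangleLoopAux h hs ht hst
  range_boundary := range_triangleLoop h

/-- The carrier of the triangle domain is the open triangle (by definition). [folklore] -/
@[simp] theorem triangleDomain_carrier (h : AffineIndependent ℝ ![a, b, c]) :
    (triangleDomain a b c h).carrier = interior (convexHull ℝ {a, b, c}) := rfl

/-- **Carleson's conformal rectangle `(Δ; a, b, c, d)`** with `d = c + s (a - c)`, `s ∈ (0, 1)`:
the open triangle with the three vertices and a fourth point of the open side `(c, a)` marked
(marks `0, 1/3, 2/3, (2 + s)/3`). Bollobás–Riordan 2006, Ch. 7 p. 163, `T_x` (with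
`a = P_1 = (1, 0)`, `b = P_2`, `c = P_3 = (0, 0)`, `d = P_4 = (x, 0)`, `s = x`). [cite: BollobasRiordan2006, Ch. 7 p. 163 (Fig. 4, T_x)] -/
def triangleRectangle (a b c : ℂ) (h : AffineIndependent ℝ ![a, b, c]) (s : ℝ)
    (hs : s ∈ Ioo (0 : ℝ) 1) : ConformalRectangle where
  toJordanDomain := triangleDomain a b c h
  mark := ![0, 1 / 3, 2 / 3, (2 + s) / 3]
  strictMono_mark := by
    refine Fin.strictMono_iff_lt_succ.2 fun i => ?_
    fin_cases i <;> simp <;> linarith [hs.1, hs.2]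
  mark_mem := by
    intro i
    fin_cases i <;> simp <;> (try constructor) <;> linarith [hs.1, hs.2]

variable (h : AffineIndependent ℝ ![a, b, c]) {s : ℝ} (hs : s ∈ Ioo (0 : ℝ) 1)

/-- The carrier of Carleson's rectangle is the open triangle (by definition). [folklore] -/
@[simp] theorem triangleRectangle_carrier :
    (triangleRectangle a b c h s hs).carrier = interior (convexHull ℝ {a, b, c}) := rfl

/-- The marked points of Carleson's rectangle are `a, b, c, c + s (a - c)`. [folklore] -/
theorem triangleRectangle_pt :
    (triangleRectangle a b c h s hs).pt 0 = a ∧ (triangleRectangle a b c h s hs).pt 1 = b ∧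
      (triangleRectangle a b c h s hs).pt 2 = c ∧
        (triangleRectangle a b c h s hs).pt 3 = c + s • (a - c) := by
  have h0 : (0 : ℝ) ∈ Ico (0 : ℝ) 1 := ⟨le_rfl, by norm_num⟩
  have h1 : (1 / 3 : ℝ) ∈ Ico (0 : ℝ) 1 := ⟨by norm_num, by norm_num⟩
  have h2 : (2 / 3 : ℝ) ∈ Ico (0 : ℝ) 1 := ⟨by norm_num, by norm_num⟩
  have h3 : ((2 + s) / 3 : ℝ) ∈ Ico (0 : ℝ) 1 := ⟨by linarith [hs.1], by linarith [hs.2]⟩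
  simp only [MarkedDomain.pt, triangleRectangle, triangleDomain, Matrix.cons_val_zero,
    Matrix.cons_val_one]
  refine ⟨?_, ?_, ?_, ?_⟩
  · rw [triangleLoop_of_mem_Ico h0, triangleLoopAux_zero]
  · rw [triangleLoop_of_mem_Ico h1, triangleLoopAux_one_third]
  · show triangleLoop a b c (![0, 1 / 3, 2 / 3, (2 + s) / 3] 2) = c
    simp only [Matrix.cons_val_two, Matrix.tail_cons, Matrix.head_cons]
    rw [triangleLoop_of_mem_Ico h2, triangleLoopAux_two_thirds]
  · show triangleLoop a b c (![0, 1 / 3, 2 / 3, (2 + s) / 3] 3) = c + s • (a - c)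
    have : (![0, 1 / 3, 2 / 3, (2 + s) / 3] : Fin 4 → ℝ) 3 = (2 + s) / 3 := rfl
    have hs3 : 3 * ((2 + s) / 3) - 2 = s := by ring
    rw [this, triangleLoop_of_mem_Ico h3, triangleLoopAux_of_two_thirds_lt (by linarith [hs.1]),
      hs3, AffineMap.lineMap_apply_module', add_comm]

/-- The fourth marked point lies on the open side `(c, a)`. [folklore] -/
theorem triangleRectangle_pt_three_mem_openSegment :
    (triangleRectangle a b c h s hs).pt 3 ∈ openSegment ℝ c a := by
  rw [(triangleRectangle_pt h hs).2.2.2, openSegment_eq_image']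
  exact ⟨s, hs, rfl⟩

/-! ### Non-degeneracy from side lengths -/

/-- Three points with equal, nonzero pairwise distances (an equilateral triangle) are affinely
independent: were they collinear, one would lie between the other two and the two short
distances would add up to the long one. [folklore] -/
theorem affineIndependent_of_dist_eq (hab : dist a b = dist b c) (hbc : dist b c = dist c a)
    (hne : a ≠ b) : AffineIndependent ℝ ![a, b, c] := by
  rw [affineIndependent_iff_not_collinear_set]
  intro hcol
  have hpos : 0 < dist a b := dist_pos.2 hne
  rcases hcol.wbtw_or_wbtw_or_wbtw with hw | hw | hw
  · have := hw.dist_add_dist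
    rw [dist_comm a c] at this
    linarith
  · have := hw.dist_add_dist
    rw [dist_comm b a] at this
    linarith
  · have := hw.dist_add_dist
    rw [dist_comm c b] at this
    linarith

end Literature.Probability.RandomPlanarGeometry

end
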